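import Summits.KontsevichZagierPeriods.KontsevichZagierPeriods.Theorems.SoloBlindInjective
import Summits.KontsevichZagierPeriods.KontsevichZagierPeriods.Theorems.SoloBlindBoxRing
import Literature.Barriers.Schanuel.AlgebraicIndependenceOfLogarithms
import Mathlib.RingTheory.AlgebraicIndependent.AlgebraicClosure
import Mathlib.RingTheory.AlgebraicIndependent.Basic
import Mathlib.Algebra.MvPolynomial.Monad
import HarnessLib

/-!
# The box sector of the Kontsevich–Zagier conjecture, IV: the transcendence input

The one transcendence statement the box sector needs, derived from the classical conjecture of
**algebraic independence of logarithms of algebraic numbers**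
(`Literature.Barriers.Schanuel.AlgIndepLogarithms`: `ℚ`-linearly independent logarithms of
algebraic numbers are algebraically independent; the first open case is the four exponentials
conjecture):

* (`algebraicIndependent_boxFamily`) if `u_k > 1` are real algebraic with `ℚ`-linearly independent
  `log u_k` and `θ_k > 0` are real algebraic with `ℚ`-linearly independent `arctan θ_k`, then the
  real family `(log u_k)_k ⊔ (arctan θ_k)_k` is algebraically independent over the field `K₀` of
  real algebraic numbers.

Route: the complex logarithms `log u_k`, `2i·arctan θ_k` (`SoloBlindInjective.cellLog`) have
algebraic exponentials and are `ℚ`-linearly independent (real and imaginary parts), so the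
conjecture makes them algebraically independent over `ℚ`, hence over `ℚ̄ ∩ ℂ`
(`AlgebraicIndependent.algebraicClosure`); rescaling the angular block by the algebraic unit
`(2i)⁻¹` (`AlgebraicIndependent.smul_of_ne_zero`) gives the complexified real family, and
algebraic independence descends along `K₀ ↪ ℚ̄ ∩ ℂ`, `ℝ ↪ ℂ`
(`AlgebraicIndependent.of_ringHom_of_comp_eq`).

References: M. Waldschmidt, *Diophantine approximation on linear algebraic groups* (2000),
Conj. 1.15; S. Lang, *Introduction to transcendental numbers* (1966), Ch. III (four exponentials).
-/

noncomputable section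

open scoped BigOperators

namespace Summit.KontsevichZagierPeriods.KontsevichZagierPeriods.Theorems

open Literature.NumberTheory.Transcendental
open Literature.NumberTheory.Transcendental.KZ
open Literature.Barriers.Schanuel (AlgIndepLogarithms)

namespace SoloBlind

/-! ## Rescaling an algebraically independent family by non-zero scalars -/

/-- An algebraically independent family stays algebraically independent when each member is
multiplied by a non-zero scalar of the base field (substitute `X_i ↦ c_i X_i`, an automorphism of
the polynomial ring). -/
theorem _root_.AlgebraicIndependent.smul_of_ne_zero {ι F E : Type*} [Field F] [CommRing E]
    [Algebra F E] {x : ι → E} (hx : AlgebraicIndependent F x) (c : ι → F) (hc : ∀ i, c i ≠ 0) :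
    AlgebraicIndependent F (fun i => c i • x i) := by
  classical
  rw [algebraicIndependent_iff] at hx ⊢
  intro p hp
  let f : ι → MvPolynomial ι F := fun i => MvPolynomial.C (c i) * MvPolynomial.X i
  have hfx : (fun i => MvPolynomial.aeval x (f i)) = fun i => c i • x i := by
    funext i
    simp only [f, map_mul, MvPolynomial.aeval_C, MvPolynomial.aeval_X, Algebra.smul_def]
  have h1 : MvPolynomial.aeval x (MvPolynomial.bind₁ f p) = 0 := by
    rw [MvPolynomial.aeval_bind₁, hfx, hp]
  have h2 := hx _ h1
  have h3 : MvPolynomial.bind₁ (fun i => MvPolynomial.C (c i)⁻¹ * MvPolynomial.X i)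
      (MvPolynomial.bind₁ f p) = p := by
    rw [MvPolynomial.bind₁_bind₁]
    have hX : (fun i => MvPolynomial.bind₁ (fun i => MvPolynomial.C (c i)⁻¹ * MvPolynomial.X i)
        (f i)) = MvPolynomial.X := by
      funext i
      simp only [f, map_mul, MvPolynomial.bind₁_C_right, MvPolynomial.bind₁_X_right]
      rw [← mul_assoc, ← MvPolynomial.C_mul, mul_inv_cancel₀ (hc i), MvPolynomial.C_1, one_mul]
    rw [hX, MvPolynomial.bind₁_X_left]
    rfl
  rw [← h3, h2, map_zero]

/-! ## The complex box family -/

section family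

variable {κ κ' : Type}

/-- The **real box family** `(log u_k)_k ⊔ (arctan θ_k)_k`. -/
def boxFamily (u : κ → ℝ) (θ : κ' → ℝ) : κ ⊕ κ' → ℝ :=
  Sum.elim (fun k => Real.log (u k)) (fun k => Real.arctan (θ k))

/-- `boxFamily` on a logarithmic index. -/
@[simp] theorem boxFamily_inl (u : κ → ℝ) (θ : κ' → ℝ) (k : κ) :
    boxFamily u θ (Sum.inl k) = Real.log (u k) := rfl

/-- `boxFamily` on an arctangent index. -/
@[simp] theorem boxFamily_inr (u : κ → ℝ) (θ : κ' → ℝ) (k : κ') :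
    boxFamily u θ (Sum.inr k) = Real.arctan (θ k) := rfl

/-- The complex logarithms `log u_k`, `2i·arctan θ_k` are `ℚ`-linearly independent as soon as the
`log u_k` and the `arctan θ_k` are (real and imaginary parts). -/
theorem linearIndependent_cellLog [Fintype κ] [Fintype κ'] (u : κ → ℝ) (θ : κ' → ℝ)
    (hu : LinearIndependent ℚ fun k => Real.log (u k))
    (hθ : LinearIndependent ℚ fun k => Real.arctan (θ k)) :
    LinearIndependent ℚ (cellLog u θ) := by
  rw [Fintype.linearIndependent_iff] at hu hθ ⊢
  intro g hg
  have hsum : ∑ m, (g m : ℂ) * cellLog u θ m = 0 := by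
    simpa only [Rat.smul_def] using hg
  have hre := congrArg Complex.re hsum
  rw [re_sum_ratCast_mul_cellLog, Complex.zero_re] at hre
  have him := congrArg Complex.im hsum
  rw [im_sum_ratCast_mul_cellLog, Complex.zero_im] at him
  have him' : ∑ k, (g (Sum.inr k) : ℝ) * Real.arctan (θ k) = 0 := by
    rcases mul_eq_zero.mp him with h | h
    · norm_num at h
    · exact h
  have h1 := hu (fun k => g (Sum.inl k)) (by simpa only [Rat.smul_def] using hre)
  have h2 := hθ (fun k => g (Sum.inr k)) (by simpa only [Rat.smul_def] using him')
  rintro (k | k)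
  exacts [h1 k, h2 k]

/-- The complex logarithms `log u_k` (`u_k > 1`), `2i·arctan θ_k` have algebraic exponentials
`u_k`, `(1 + iθ_k)/(1 − iθ_k)`. -/
theorem isAlgebraic_exp_cellLog (u : κ → ℝ) (θ : κ' → ℝ) (hu : ∀ k, IsAlgebraic ℚ (u k) ∧ 1 < u k)
    (hθ : ∀ k, IsAlgebraic ℚ (θ k)) (m : κ ⊕ κ') :
    IsAlgebraic ℚ (Complex.exp (cellLog u θ m)) := by
  rcases m with k | k
  · simp only [cellLog, Sum.elim_inl]
    rw [← Complex.ofReal_exp, Real.exp_log (one_pos.trans (hu k).2)]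
    exact (isAlgebraic_algebraMap_iff (A := ℂ) Complex.ofReal_injective).mpr (hu k).1
  · simp only [cellLog, Sum.elim_inr]
    exact isAlgebraic_exp_two_arctan_mul_I (hθ k)

/-- **Under `AlgIndepLogarithms`, the complex logarithms `log u_k`, `2i·arctan θ_k` are
algebraically independent over `ℚ`.** -/
theorem algebraicIndependent_cellLog [Fintype κ] [Fintype κ'] (h : AlgIndepLogarithms)
    (u : κ → ℝ) (θ : κ' → ℝ)
    (hu : ∀ k, IsAlgebraic ℚ (u k) ∧ 1 < u k) (hθ : ∀ k, IsAlgebraic ℚ (θ k))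
    (hli : LinearIndependent ℚ fun k => Real.log (u k))
    (hli' : LinearIndependent ℚ fun k => Real.arctan (θ k)) :
    AlgebraicIndependent ℚ (cellLog u θ) := by
  let e := (Fintype.equivFin (κ ⊕ κ')).symm
  have h' := h _ (cellLog u θ ∘ e) (fun i => isAlgebraic_exp_cellLog u θ hu hθ (e i))
    ((linearIndependent_cellLog u θ hli hli').comp e e.injective)
  exact (algebraicIndependent_equiv e).mp h'

/-! ## Descent to the real family over `K₀` -/

/-- The field `ℚ̄ ∩ ℂ` of complex algebraic numbers. -/
abbrev Kc : IntermediateField ℚ ℂ := algebraicClosure ℚ ℂ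

/-- `(2i)⁻¹` is algebraic (`i` is: `Literature.NumberTheory.Transcendental.KoblitzOgus.isAlgebraic_I`;
re-derived inline to keep the import light). -/
theorem isAlgebraic_inv_two_mul_I : IsAlgebraic ℚ (2 * Complex.I)⁻¹ := by
  have hI : IsAlgebraic ℚ Complex.I :=
    (isAlgebraic_ofReal_add_mul_I_of_div isAlgebraic_one isAlgebraic_one isAlgebraic_one
      isAlgebraic_one).2.2
  have h2 : IsAlgebraic ℚ (2 * Complex.I) := by
    rw [two_mul]
    exact hI.add hI
  exact h2.inv

/-- The rescaling units: `1` on the logarithmic block, `(2i)⁻¹` on the angular block. -/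
def boxUnits (κ κ' : Type) : κ ⊕ κ' → Kc :=
  Sum.elim (fun _ => 1) (fun _ => ⟨(2 * Complex.I)⁻¹, mem_algebraicClosure_iff.mpr
    isAlgebraic_inv_two_mul_I⟩)

/-- The rescaling units are non-zero. -/
theorem boxUnits_ne_zero (m : κ ⊕ κ') : boxUnits κ κ' m ≠ 0 := by
  rcases m with k | k
  · exact one_ne_zero
  · intro h
    have h' := congrArg Subtype.val h
    simp only [boxUnits, Sum.elim_inr, ZeroMemClass.coe_zero, inv_eq_zero, mul_eq_zero,
      Complex.I_ne_zero, or_false] at h'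
    norm_num at h'

/-- Rescaling the complex logarithms by the units gives the complexified real box family. -/
theorem boxUnits_smul_cellLog (u : κ → ℝ) (θ : κ' → ℝ) (m : κ ⊕ κ') :
    boxUnits κ κ' m • cellLog u θ m = ((boxFamily u θ m : ℝ) : ℂ) := by
  rcases m with k | k
  · simp only [boxUnits, Sum.elim_inl, one_smul, cellLog, boxFamily]
  · rw [IntermediateField.smul_def, smul_eq_mul]
    simp only [boxUnits, cellLog, boxFamily, Sum.elim_inr]
    have hI : (2 : ℂ) * Complex.I ≠ 0 := mul_ne_zero two_ne_zero Complex.I_ne_zero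
    calc (2 * Complex.I)⁻¹ * (((2 * Real.arctan (θ k) : ℝ) : ℂ) * Complex.I)
          = (2 * Complex.I)⁻¹ * (2 * Complex.I) * ((Real.arctan (θ k) : ℝ) : ℂ) := by
            push_cast; ring
      _ = ((Real.arctan (θ k) : ℝ) : ℂ) := by rw [inv_mul_cancel₀ hI, one_mul]

/-- The embedding `K₀ = ℚ̄ ∩ ℝ ↪ ℚ̄ ∩ ℂ = Kc`. -/
def K₀toKc : K₀ →+* Kc where
  toFun β := ⟨((β : ℝ) : ℂ), mem_algebraicClosure_iff.mpr
    ((isAlgebraic_algebraMap_iff (A := ℂ) Complex.ofReal_injective).mpr (K₀.isAlgebraic β))⟩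
  map_one' := Subtype.ext (by simp)
  map_mul' β γ := Subtype.ext (by simp)
  map_zero' := Subtype.ext (by simp)
  map_add' β γ := Subtype.ext (by simp)

/-- The embedding on elements. -/
@[simp] theorem coe_K₀toKc (β : K₀) : ((K₀toKc β : Kc) : ℂ) = ((β : ℝ) : ℂ) := rfl

/-- The embedding `K₀ ↪ Kc` is injective. -/
theorem K₀toKc_injective : Function.Injective K₀toKc := fun β γ h =>
  Subtype.ext (Complex.ofReal_injective (by simpa using congrArg Subtype.val h))

/-- The square `K₀ → Kc → ℂ` = `K₀ → ℝ → ℂ` commutes. -/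
theorem algebraMap_comp_K₀toKc :
    (algebraMap Kc ℂ).comp K₀toKc = Complex.ofRealHom.comp (algebraMap K₀ ℝ) :=
  RingHom.ext fun _ => rfl

/-- **The transcendence input of the box sector.**  Under `AlgIndepLogarithms`: if `u_k > 1` are
real algebraic with `ℚ`-linearly independent logarithms and `θ_k > 0` are real algebraic with
`ℚ`-linearly independent arctangents, then `(log u_k)_k ⊔ (arctan θ_k)_k` is algebraically
independent over the field `K₀` of real algebraic numbers. -/
theorem algebraicIndependent_boxFamily [Fintype κ] [Fintype κ'] (h : AlgIndepLogarithms)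
    (u : κ → ℝ) (θ : κ' → ℝ)
    (hu : ∀ k, IsAlgebraic ℚ (u k) ∧ 1 < u k) (hθ : ∀ k, IsAlgebraic ℚ (θ k))
    (hli : LinearIndependent ℚ fun k => Real.log (u k))
    (hli' : LinearIndependent ℚ fun k => Real.arctan (θ k)) :
    AlgebraicIndependent K₀ (boxFamily u θ) := by
  have hC : AlgebraicIndependent Kc (cellLog u θ) :=
    (algebraicIndependent_cellLog h u θ hu hθ hli hli').algebraicClosure
  have hC' : AlgebraicIndependent Kc (Complex.ofRealHom ∘ boxFamily u θ) := by
    have := hC.smul_of_ne_zero (boxUnits κ κ') boxUnits_ne_zero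
    convert this using 1
    funext m
    rw [boxUnits_smul_cellLog]
    rfl
  exact hC'.of_ringHom_of_comp_eq K₀toKc Complex.ofRealHom K₀toKc_injective
    algebraMap_comp_K₀toKc

end family

end SoloBlind

end Summit.KontsevichZagierPeriods.KontsevichZagierPeriods.Theorems
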